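import Summits.Schanuel.Schanuel.Theses.TateNomes
import Literature.Barriers.Schanuel.NesterenkoModularScopeValuesProofs
import Literature.NumberTheory.ModularForms.QuasimodularPhi
import Literature.NumberTheory.ModularForms.Lemma49Plus8

/-!
# Crux-ideate sketches for `TateLocusGPCOne` (stmt-Schanuel-17406), ideator 1, round 1

First lemmas of the two idea cards, stated over existing declarations (nothing here is a
Theorems proposal):

* card `fricke-partner-nome` — the S-partner nome `q' = e^{-2πi/τ}`, the eight cusp-values
  `(q, P, Q, R)(q) ∪ (q, P, Q, R)(q')`, the covariance identities (PROVED below from the tree's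
  `E2_S_smul`, `E₄_S_smul`, `E₆_S_smul`, `ramanujanP/Q/R_cexp`), the transfer statement
  `IsoNomeSix → TateLocusGPCOne` and the uniform two-nome form `BiNomeSix`.
* card `mirror-coordinate-g-values` — the degree-graded, deep-cusp, algebraic-λ fibre statements
  `LegendreCuspGraded δ` (parasite-free, implied by the crux) and `BombieriAndreRung δ` (the
  shape a G-function engine outputs: with the `log 16n` parasite).
-/

noncomputable section

set_option linter.dupNamespace false

open Complex IntermediateField
open UpperHalfPlane hiding I
open scoped Real MatrixGroups

namespace Summit.Schanuel.Schanuel.Cruxes.TateLocusGPCOne.Ideator1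

/-! ## Common vocabulary (spelled exactly as in the route file) -/

/-- Ramanujan's `P` as the inline `q`-series of the route file (`rfl`-equal to
`Literature.Barriers.Schanuel.ramanujanP`). -/
def Pq (q : ℂ) : ℂ := 1 - 24 * ∑' l : ℕ, (ArithmeticFunction.sigma 1 (l + 1) : ℂ) * q ^ (l + 1)
/-- Ramanujan's `Q` (inline spelling). -/
def Qq (q : ℂ) : ℂ := 1 + 240 * ∑' l : ℕ, (ArithmeticFunction.sigma 3 (l + 1) : ℂ) * q ^ (l + 1)
/-- Ramanujan's `R` (inline spelling). -/
def Rq (q : ℂ) : ℂ := 1 - 504 * ∑' l : ℕ, (ArithmeticFunction.sigma 5 (l + 1) : ℂ) * q ^ (l + 1)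

theorem Pq_eq (q : ℂ) : Pq q = Literature.Barriers.Schanuel.ramanujanP q := rfl
theorem Qq_eq (q : ℂ) : Qq q = Literature.Barriers.Schanuel.ramanujanQ q := rfl
theorem Rq_eq (q : ℂ) : Rq q = Literature.Barriers.Schanuel.ramanujanR q := rfl

/-- The nome `q = e^{2πiτ}`. -/
def nome (τ : ℂ) : ℂ := cexp (2 * π * I * τ)

/-- `2πi`, spelled as in the route file. -/
def twoPiI : ℂ := 2 * (Real.pi : ℂ) * Complex.I

/-- "`τ` is not a root of a monic rational quadratic" (the crux's non-CM clause). -/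
def NonQuadratic (τ : ℂ) : Prop := ∀ b c : ℚ, τ ^ 2 + (b : ℂ) * τ + (c : ℂ) ≠ 0

/-- The six crux generators `(2πi, τ, q, P, Q, R)`. -/
def sixValues (τ : ℂ) : Set ℂ :=
  {twoPiI, τ, nome τ, Pq (nome τ), Qq (nome τ), Rq (nome τ)}

/-- The crux through this file's vocabulary (definitional). -/
theorem crux_iff :
    Summit.Schanuel.Schanuel.Theses.TateNomes.TateLocusGPCOne ↔
      ∀ τ : ℂ, 0 < τ.im → NonQuadratic τ →
        (5 : Cardinal) ≤ Algebra.trdeg ℚ ↥(adjoin ℚ (sixValues τ)) :=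
  Iff.rfl

/-! ## Card 1 `fricke-partner-nome`: the S-partner nome and the eight cusp-values -/

/-- The S-partner `−1/τ` (the other cusp of the same lattice `ℤ + τℤ`). -/
def partner (τ : ℂ) : ℂ := -τ⁻¹

/-- The eight cusp-values: `(q, P, Q, R)` at `q = e^{2πiτ}` and at `q' = e^{−2πi/τ}`. Every one of
them is the value of an integral `q`-series (Nesterenko's D-closed system `z, P, Q, R`) at a point
of the punctured disc; `τ` and `2πi` do not occur. -/
def eightValues (τ : ℂ) : Set ℂ :=
  {nome τ, Pq (nome τ), Qq (nome τ), Rq (nome τ),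
   nome (partner τ), Pq (nome (partner τ)), Qq (nome (partner τ)), Rq (nome (partner τ))}

/-- **C⁺ (iso-nome six).** For non-quadratic `τ` the eight cusp-values have transcendence degree
at least `6 = 3·2` (GPC count: `dim G_mot(h¹(E_τ) ⊕ [ℤ² → 𝔾_m; (q, q')]) = 4 + 2`; the pair
`q, q'` is multiplicatively independent EXACTLY when `τ` is non-quadratic). -/
def IsoNomeSix : Prop :=
  ∀ τ : ℂ, 0 < τ.im → NonQuadratic τ →
    (6 : Cardinal) ≤ Algebra.trdeg ℚ ↥(adjoin ℚ (eightValues τ))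

/-- **Transfer** (first lemma of the line; provable now, size M): `IsoNomeSix → crux`. Mechanism:
`Q' = τ⁴Q`, `R' = τ⁶R`, `P' = τ²P − 6iτ/π` put `P', Q', R'` inside `ℚ(2πi, τ, P, Q, R)`, so
`ℚ(eight) ⊆ ℚ(six)(q')` and `6 ≤ trdeg ℚ(eight) ≤ trdeg ℚ(six) + 1`. -/
def IsoNomeTransfer : Prop :=
  IsoNomeSix → Summit.Schanuel.Schanuel.Theses.TateNomes.TateLocusGPCOne

/-- Converse direction of the dictionary (also provable now): for non-quadratic `τ`,
`τ² = R'Q/(RQ')` and `π = −6iτ/(P' − τ²P)`, so `τ` and `π` are algebraic over `ℚ(eight)`: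
the crux's two cusp-invisible generators are algebraic functions of cusp-values. -/
def CuspInvisiblesAlgebraic : Prop :=
  ∀ τ : ℂ, 0 < τ.im → NonQuadratic τ →
    IsAlgebraic ↥(adjoin ℚ (eightValues τ)) τ ∧ IsAlgebraic ↥(adjoin ℚ (eightValues τ)) (π : ℂ)

/-- **Uniform two-nome form (BiNomeSix).** For two nomes `q₁ = e^{2πiτ₁}`, `q₂ = e^{2πiτ₂}` that
are multiplicatively independent (`q₁^a q₂^b ≠ 1` for `(a,b) ≠ 0`, written additively) and not
BOTH CM, the eight values have transcendence degree `≥ 6`. Specialises to `IsoNomeSix`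
(`τ₂ = −1/τ₁`: multiplicative independence ⟺ `τ₁` non-quadratic) and to the `m = 2` analogue of
the route's `MultiNomeNesterenko` (GL₂⁺(ℚ)-inequivalent pair). Two CM nomes give only `5`
(shared `π`), hence the last hypothesis. -/
def BiNomeSix : Prop :=
  ∀ τ₁ τ₂ : ℂ, 0 < τ₁.im → 0 < τ₂.im →
    (∀ a b : ℤ, (a : ℂ) * τ₁ + (b : ℂ) * τ₂ ∈ (Set.range (Int.cast : ℤ → ℂ)) → a = 0 ∧ b = 0) →
    (NonQuadratic τ₁ ∨ NonQuadratic τ₂) →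
    (6 : Cardinal) ≤ Algebra.trdeg ℚ ↥(adjoin ℚ
      ({nome τ₁, Pq (nome τ₁), Qq (nome τ₁), Rq (nome τ₁),
        nome τ₂, Pq (nome τ₂), Qq (nome τ₂), Rq (nome τ₂)} : Set ℂ))

/-! ### The covariance identities, PROVED from tree facts -/

open Literature.NumberTheory.ModularForms in
/-- `e^{2πi(−1/τ)}` is the nome of `S • τ`. -/
theorem nome_partner (τ : ℍ) :
    nome (partner (τ : ℂ)) = cexp (2 * π * I * ((ModularGroup.S • τ : ℍ) : ℂ)) := by
  rw [coe_S_smul]; rfl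

open Literature.NumberTheory.ModularForms ModularForm in
/-- **S-covariance of the eight values** (LNM 1752 Ch. 1; CKMRV (2.4)):
`Q(q') = τ⁴Q(q)`, `R(q') = τ⁶R(q)`, `P(q') = τ²P(q) − 6iτ/π`. -/
theorem partner_covariance (τ : ℍ) :
    Qq (nome (partner (τ : ℂ))) = (τ : ℂ) ^ 4 * Qq (nome τ) ∧
    Rq (nome (partner (τ : ℂ))) = (τ : ℂ) ^ 6 * Rq (nome τ) ∧
    Pq (nome (partner (τ : ℂ))) = (τ : ℂ) ^ 2 * Pq (nome τ) - 6 * I * (τ : ℂ) / π := by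
  refine ⟨?_, ?_, ?_⟩
  · rw [nome_partner, Qq_eq, Qq_eq, nome, Literature.Barriers.Schanuel.ramanujanQ_cexp,
      Literature.Barriers.Schanuel.ramanujanQ_cexp, E₄_S_smul]
  · rw [nome_partner, Rq_eq, Rq_eq, nome, Literature.Barriers.Schanuel.ramanujanR_cexp,
      Literature.Barriers.Schanuel.ramanujanR_cexp, E₆_S_smul]
  · rw [nome_partner, Pq_eq, Pq_eq, nome, Literature.Barriers.Schanuel.ramanujanP_cexp,
      Literature.Barriers.Schanuel.ramanujanP_cexp, E2_S_smul]

open Literature.NumberTheory.ModularForms ModularForm in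
/-- **`π²` is a rational function of six cusp-values** (new identity, valid on all of `ℍ`
off the `i`- and `ρ`-orbits): with `t = R(q')Q(q)/(R(q)Q(q')) (= τ²)`,
`π² · (P(q') − t·P(q))² = −36 t`. Stated multiplied out. -/
theorem pi_sq_identity (τ : ℍ) :
    (π : ℂ) ^ 2 * (Pq (nome (partner (τ : ℂ))) - (τ : ℂ) ^ 2 * Pq (nome τ)) ^ 2
      = -36 * (τ : ℂ) ^ 2 := by
  obtain ⟨-, -, hP⟩ := partner_covariance τ
  rw [hP]
  have hπ : (π : ℂ) ≠ 0 := ofReal_ne_zero.2 Real.pi_ne_zero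
  field_simp
  ring_nf
  simp [Complex.I_sq]

/-! ## Card 2 `mirror-coordinate-g-values`: degree-graded statements on the deep algebraic-λ fibre

Fibre: `τ = iy`, `y > 1`, with Legendre modulus `λ(iy) = 1/n` (`n ≥ 2`), written through
`j = 1728 Q³/(Q³ − R²) = 256 (n² − n + 1)³ / (n²(n − 1)²)`, i.e.
`27 Q³ n²(n−1)² = 4 (n²−n+1)³ (Q³ − R²)` at `q = e^{−2πy}`; on the imaginary half-axis `y ≥ 1`
this pins `y = K'(1/√n)/K(1/√n)` uniquely. In the cusp coordinate `λ` one has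
`πiτ = log(λ/16) + G(λ)/F(λ)` with `F = ₂F₁(½,½;1;λ)`, `G` a G-function — so `τ` HAS a cusp
expansion (Nilsson class), and Bombieri–André's principle of global relations applies at `λ = 1/n`. -/

/-- The Legendre deep-cusp fibre condition at level `n` for `q = e^{−2πy}`. -/
def LegendreFibre (n : ℕ) (y : ℝ) : Prop :=
  1 ≤ y ∧ 27 * Qq (nome (I * y)) ^ 3 * ((n : ℂ) ^ 2 * ((n : ℂ) - 1) ^ 2)
    = 4 * ((n : ℂ) ^ 2 - n + 1) ^ 3 * (Qq (nome (I * y)) ^ 3 - Rq (nome (I * y)) ^ 2)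

/-- **Parasite-free graded rung** (implied by the crux; the line's typed target on this fibre):
for each degree `δ` there is `B` such that on every Legendre fibre of level `n ≥ B` the three
numbers `(π·y, P, Q)` (`π y = −½ log q`) satisfy no integer algebraic relation of degree `≤ δ`. -/
def LegendreCuspGraded (δ : ℕ) : Prop :=
  ∃ B : ℕ, ∀ n : ℕ, B ≤ n → ∀ y : ℝ, LegendreFibre n y → NonQuadratic (I * y) →
    ∀ A : MvPolynomial (Fin 3) ℤ, A ≠ 0 → A.totalDegree ≤ δ →
      MvPolynomial.aeval ![((π * y : ℝ) : ℂ), Pq (nome (I * y)), Qq (nome (I * y))] A ≠ 0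

/-- **Bombieri–André rung** (the shape the G-function engine outputs; NOT implied by the crux
alone because of the `𝔾_m`-period `log 16n` of the Kummer motive `[ℤ → 𝔾_m; 16n]`): no relation
of degree `≤ δ` among `(log(16n) − π y, P, Q) = (G/F, …)(1/n)` for `n ≥ B(δ)`. -/
def BombieriAndreRung (δ : ℕ) : Prop :=
  ∃ B : ℕ, ∀ n : ℕ, B ≤ n → ∀ y : ℝ, LegendreFibre n y → NonQuadratic (I * y) →
    ∀ A : MvPolynomial (Fin 3) ℤ, A ≠ 0 → A.totalDegree ≤ δ →
      MvPolynomial.aeval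
        ![((Real.log (16 * n) - π * y : ℝ) : ℂ), Pq (nome (I * y)), Qq (nome (I * y))] A ≠ 0

/-- The crux implies every parasite-free graded rung (provable now, size M: on the fibre `R` is
algebraic over `Q`, so the crux makes `(π, y, q, P, Q)` algebraically independent; the non-quadratic
clause is carried as a hypothesis of the rung — the finitely many CM levels `n` (e.g. `n = 2`, `τ = i`,
where `P·(πy) = 3`) would otherwise need the class-number-one list). -/
def CruxGivesGraded : Prop :=
  Summit.Schanuel.Schanuel.Theses.TateNomes.TateLocusGPCOne → ∀ δ : ℕ, LegendreCuspGraded δ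

end Summit.Schanuel.Schanuel.Cruxes.TateLocusGPCOne.Ideator1
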